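import Summits.Ventures.PercRepro.HyperplaneKey
import Summits.Ventures.PercRepro.HyperplaneKeyCount
import Summits.Ventures.PercRepro.S2LPPhi
import Summits.Ventures.PercRepro.RankLevelSetLocalSparse
import Summits.Ventures.PercRepro.RankLevelSetPlaneSix
import Summits.Ventures.PercRepro.RankLevelSetPlaneTen
import Summits.Ventures.PercRepro.RankLevelSetPlaneTenPrime

/-!
# PercRepro — THE HYPERPLANE KEY AT LEVEL `5`: THE LARGE-CORANK TAILS OF THE ROWS `8 … 14` (p1, gen 42; S2 feeder)

The `e`-free flat bounds `f(0 … 5) = 0, 1, 3, 6, 10, 19` and the basis-fibre count give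
`#{ρ ≤ 5} ≤ 1 + n + 2·C(n,2) + 8·C(n,3) + 64·C(n,4) + 2^14·C(n,5) ≤ P(n) := 1 + n + n² + (4/3)n³ + (8/3)n⁴ + (2048/15)n⁵`
(`Nat.choose_le_pow_div`); `P(n + 2) ≤ 2·P(n)` from `n = 14` on, so `(Φ + 1)·P(n) ≤ 2^{⌊n/2⌋}` propagates from two
consecutive base values. With the hyperplane key this closes **`ThmN.RLS M p 5` for every `e`-free `M` of rank `p`
on `n ≥ n₀(p)` points, `n₀ = 82 / 84 / 86 / 86 / 88 / 90 / 92` at `p = 8 … 14`** (`c025_core_five_hyperplane_key_<p>`),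
i.e. the cells `(p, d)` with `d ≥ 74 / 75 / 76 / 75 / 76 / 77 / 78`. Nothing else is claimed; in particular nothing
about the cells below these coranks.

* `ncard_eRk_le_five_le_of_free` — the binomial cap; `ncard_eRk_le_five_le_poly_of_free` — the polynomial cap in `ℚ`;
* `poly_two_step` — `P(n + 2) ≤ 2·P(n)` for `n ≥ 14`; `key_of_two_base` — the two-step induction;
* `c025_core_five_hyperplane_key_eight` … `_fourteen`.
Axioms: standard.
-/

open scoped Matroid

namespace PercRepro

namespace HypKey

open Set

variable {α : Type}

/-- **The rank-`≤ 5` count of an `e`-free matroid**: `#{ρ ≤ 5} ≤ 1 + n + 2·C(n,2) + 8·C(n,3) + 64·C(n,4) + 16384·C(n,5)`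
(the flat bounds `0, 1, 3, 6, 10, 19` in the basis-fibre count). -/
theorem ncard_eRk_le_five_le_of_free (M : Matroid α) [M.Finite]
    (hfree : ∀ e ∈ M.E, ∃ A ⊆ M.E \ {e}, e ∉ M.closure A ∧ e ∉ M.closure ((M.E \ {e}) \ A)) :
    {X : Set α | X ⊆ M.E ∧ M.eRk X ≤ (5 : ℕ∞)}.ncard ≤
      1 + M.E.ncard + 2 * M.E.ncard.choose 2 + 8 * M.E.ncard.choose 3 + 64 * M.E.ncard.choose 4
        + 16384 * M.E.ncard.choose 5 := by
  have hL := ThmN.not_isLoop_of_free M hfree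
  have hf : ∀ j : ℕ, j ≤ 5 → ∀ X ⊆ M.E, M.eRk X ≤ (j : ℕ∞) → X.ncard ≤
      (if j = 0 then 0 else if j = 1 then 1 else if j = 2 then 3 else if j = 3 then 6
        else if j = 4 then 10 else 19) := by
    intro j hj X hX hr
    interval_cases j
    · have := ThmN.ncard_add_one_le_two_pow_of_eRk_le M hL hfree 0 X hX (by simpa using hr)
      simp only [if_true]
      omega
    · have := ThmN.ncard_add_one_le_two_pow_of_eRk_le M hL hfree 1 X hX (by simpa using hr)
      simp only [one_ne_zero, if_false, if_true]
      omega
    · have := ThmN.ncard_add_one_le_two_pow_of_eRk_le M hL hfree 2 X hX (by simpa using hr)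
      norm_num
      omega
    · norm_num
      exact ThmN.ncard_le_six_of_eRk_le_three_of_free M hfree hX (by simpa using hr)
    · norm_num
      exact ThmN.ncard_le_ten_of_eRk_le_four_of_free M hfree hX (by simpa using hr)
    · norm_num
      exact ThmN.ncard_le_nineteen_of_eRk_le_five_of_free M hfree hX (by simpa using hr)
  have h := ncard_eRk_le_le_sum_choose M 5
    (fun j => if j = 0 then 0 else if j = 1 then 1 else if j = 2 then 3 else if j = 3 then 6
      else if j = 4 then 10 else 19) hf
  simp only [Finset.sum_range_succ, Finset.sum_range_zero] at h
  norm_num at h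
  linarith [h]

/-- The polynomial form in `ℚ`: `#{ρ ≤ 5} ≤ 1 + n + n² + (4/3)n³ + (8/3)n⁴ + (2048/15)n⁵` (`C(n, j) ≤ n^j / j!`). -/
theorem ncard_eRk_le_five_le_poly_of_free (M : Matroid α) [M.Finite]
    (hfree : ∀ e ∈ M.E, ∃ A ⊆ M.E \ {e}, e ∉ M.closure A ∧ e ∉ M.closure ((M.E \ {e}) \ A)) :
    ({X : Set α | X ⊆ M.E ∧ M.eRk X ≤ (5 : ℕ∞)}.ncard : ℚ) ≤
      1 + (M.E.ncard : ℚ) + (M.E.ncard : ℚ) ^ 2 + 4 / 3 * (M.E.ncard : ℚ) ^ 3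
        + 8 / 3 * (M.E.ncard : ℚ) ^ 4 + 2048 / 15 * (M.E.ncard : ℚ) ^ 5 := by
  have h := ncard_eRk_le_five_le_of_free M hfree
  have hq : ({X : Set α | X ⊆ M.E ∧ M.eRk X ≤ (5 : ℕ∞)}.ncard : ℚ) ≤
      1 + (M.E.ncard : ℚ) + 2 * (M.E.ncard.choose 2 : ℚ) + 8 * (M.E.ncard.choose 3 : ℚ)
        + 64 * (M.E.ncard.choose 4 : ℚ) + 16384 * (M.E.ncard.choose 5 : ℚ) := by
    exact_mod_cast h
  have h2 := Nat.choose_le_pow_div (α := ℚ) 2 M.E.ncard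
  have h3 := Nat.choose_le_pow_div (α := ℚ) 3 M.E.ncard
  have h4 := Nat.choose_le_pow_div (α := ℚ) 4 M.E.ncard
  have h5 := Nat.choose_le_pow_div (α := ℚ) 5 M.E.ncard
  simp only [Nat.factorial] at h2 h3 h4 h5
  push_cast at h2 h3 h4 h5
  linarith

/-- `P(n + 2) ≤ 2·P(n)` for `n ≥ 14`, `P(n) = 1 + n + n² + (4/3)n³ + (8/3)n⁴ + (2048/15)n⁵`. -/
theorem poly_two_step (n : ℕ) (hn : 14 ≤ n) :
    (1 + ((n + 2 : ℕ) : ℚ) + ((n + 2 : ℕ) : ℚ) ^ 2 + 4 / 3 * ((n + 2 : ℕ) : ℚ) ^ 3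
        + 8 / 3 * ((n + 2 : ℕ) : ℚ) ^ 4 + 2048 / 15 * ((n + 2 : ℕ) : ℚ) ^ 5) ≤
      2 * (1 + (n : ℚ) + (n : ℚ) ^ 2 + 4 / 3 * (n : ℚ) ^ 3 + 8 / 3 * (n : ℚ) ^ 4
        + 2048 / 15 * (n : ℚ) ^ 5) := by
  obtain ⟨m, rfl⟩ := Nat.exists_eq_add_of_le hn
  push_cast
  nlinarith [pow_nonneg (Nat.cast_nonneg (α := ℚ) m) 2, pow_nonneg (Nat.cast_nonneg (α := ℚ) m) 3,
    pow_nonneg (Nat.cast_nonneg (α := ℚ) m) 4, pow_nonneg (Nat.cast_nonneg (α := ℚ) m) 5,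
    Nat.cast_nonneg (α := ℚ) m]

/-- Two consecutive base values and the two-step monotonicity `P(n + 2) ≤ 2·P(n)` propagate `P(n) ≤ 2^{⌊n/2⌋}`. -/
theorem key_of_two_base (P : ℕ → ℚ) (n₀ : ℕ) (hmono : ∀ n, n₀ ≤ n → P (n + 2) ≤ 2 * P n)
    (h0 : P n₀ ≤ (2 : ℚ) ^ (n₀ / 2)) (h1 : P (n₀ + 1) ≤ (2 : ℚ) ^ ((n₀ + 1) / 2)) :
    ∀ n, n₀ ≤ n → P n ≤ (2 : ℚ) ^ (n / 2) := by
  have key : ∀ m : ℕ, P (n₀ + m) ≤ (2 : ℚ) ^ ((n₀ + m) / 2) ∧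
      P (n₀ + m + 1) ≤ (2 : ℚ) ^ ((n₀ + m + 1) / 2) := by
    intro m
    induction m with
    | zero => exact ⟨by simpa using h0, by simpa using h1⟩
    | succ m ih =>
      refine ⟨by simpa [Nat.add_assoc] using ih.2, ?_⟩
      have h2 : (n₀ + (m + 1) + 1) / 2 = (n₀ + m) / 2 + 1 := by omega
      rw [h2, pow_succ]
      have := hmono (n₀ + m) (by omega)
      calc P (n₀ + (m + 1) + 1) = P (n₀ + m + 2) := by ring_nf
        _ ≤ 2 * P (n₀ + m) := this
        _ ≤ 2 * (2 : ℚ) ^ ((n₀ + m) / 2) := by linarith [ih.1]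
        _ = (2 : ℚ) ^ ((n₀ + m) / 2) * 2 := by ring
  intro n hn
  obtain ⟨m, rfl⟩ := Nat.exists_eq_add_of_le hn
  exact (key m).1

/-- The key inequality `c·P(n) ≤ 2^{⌊n/2⌋}` for all `n ≥ n₀` from its two base values (`c ≥ 0`, `n₀ ≥ 14`). -/
theorem key_poly_of_two_base (c : ℚ) (hc : 0 ≤ c) (n₀ : ℕ) (hn₀ : 14 ≤ n₀)
    (h0 : c * (1 + (n₀ : ℚ) + (n₀ : ℚ) ^ 2 + 4 / 3 * (n₀ : ℚ) ^ 3 + 8 / 3 * (n₀ : ℚ) ^ 4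
        + 2048 / 15 * (n₀ : ℚ) ^ 5) ≤ (2 : ℚ) ^ (n₀ / 2))
    (h1 : c * (1 + ((n₀ + 1 : ℕ) : ℚ) + ((n₀ + 1 : ℕ) : ℚ) ^ 2 + 4 / 3 * ((n₀ + 1 : ℕ) : ℚ) ^ 3
        + 8 / 3 * ((n₀ + 1 : ℕ) : ℚ) ^ 4 + 2048 / 15 * ((n₀ + 1 : ℕ) : ℚ) ^ 5) ≤ (2 : ℚ) ^ ((n₀ + 1) / 2)) :
    ∀ n, n₀ ≤ n → c * (1 + (n : ℚ) + (n : ℚ) ^ 2 + 4 / 3 * (n : ℚ) ^ 3 + 8 / 3 * (n : ℚ) ^ 4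
        + 2048 / 15 * (n : ℚ) ^ 5) ≤ (2 : ℚ) ^ (n / 2) := by
  refine key_of_two_base (fun n => c * (1 + (n : ℚ) + (n : ℚ) ^ 2 + 4 / 3 * (n : ℚ) ^ 3
    + 8 / 3 * (n : ℚ) ^ 4 + 2048 / 15 * (n : ℚ) ^ 5)) n₀ (fun n hn => ?_) h0 h1
  have := poly_two_step n (le_trans hn₀ hn)
  nlinarith [this, hc]

/-- **The hyperplane key at level `5`, the row `p`**: `e`-free, `ρ(E) = p`, `(Φ(p, 5) + 1) · P(n) ≤ 2^{⌊n/2⌋}` give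
`RLS M p 5`. -/
theorem rls_five_of_poly_key (M : Matroid α) [M.Finite] (p : ℕ) (hR : M.eRank = (p : ℕ∞))
    (hfree : ∀ e ∈ M.E, ∃ A ⊆ M.E \ {e}, e ∉ M.closure A ∧ e ∉ M.closure ((M.E \ {e}) \ A))
    (hkey : (phiK p 5 + 1) * (1 + (M.E.ncard : ℚ) + (M.E.ncard : ℚ) ^ 2 + 4 / 3 * (M.E.ncard : ℚ) ^ 3
        + 8 / 3 * (M.E.ncard : ℚ) ^ 4 + 2048 / 15 * (M.E.ncard : ℚ) ^ 5) ≤ (2 : ℚ) ^ (M.E.ncard / 2)) :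
    ThmN.RLS M p 5 :=
  rls_of_hyperplane_key M p 5 hR hfree _ (ncard_eRk_le_five_le_poly_of_free M hfree) hkey

/-- **The row `p = 8` from `n = 82` on** (`d ≥ 74`). -/
theorem c025_core_five_hyperplane_key_eight (M : Matroid α) [M.Finite] (hR : M.eRank = ((8 : ℕ) : ℕ∞))
    (hn : 82 ≤ M.E.ncard)
    (hfree : ∀ e ∈ M.E, ∃ A ⊆ M.E \ {e}, e ∉ M.closure A ∧ e ∉ M.closure ((M.E \ {e}) \ A)) :
    ThmN.RLS M 8 5 := by
  refine rls_five_of_poly_key M 8 hR hfree ?_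
  rw [S2LP.phiK_eight_five]
  exact key_poly_of_two_base _ (by norm_num) 82 (by norm_num) (by norm_num) (by norm_num) _ hn

/-- **The row `p = 9` from `n = 84` on** (`d ≥ 75`). -/
theorem c025_core_five_hyperplane_key_nine (M : Matroid α) [M.Finite] (hR : M.eRank = ((9 : ℕ) : ℕ∞))
    (hn : 84 ≤ M.E.ncard)
    (hfree : ∀ e ∈ M.E, ∃ A ⊆ M.E \ {e}, e ∉ M.closure A ∧ e ∉ M.closure ((M.E \ {e}) \ A)) :
    ThmN.RLS M 9 5 := by
  refine rls_five_of_poly_key M 9 hR hfree ?_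
  rw [S2LP.phiK_nine_five]
  exact key_poly_of_two_base _ (by norm_num) 84 (by norm_num) (by norm_num) (by norm_num) _ hn

/-- **The row `p = 10` from `n = 86` on** (`d ≥ 76`). -/
theorem c025_core_five_hyperplane_key_ten (M : Matroid α) [M.Finite] (hR : M.eRank = ((10 : ℕ) : ℕ∞))
    (hn : 86 ≤ M.E.ncard)
    (hfree : ∀ e ∈ M.E, ∃ A ⊆ M.E \ {e}, e ∉ M.closure A ∧ e ∉ M.closure ((M.E \ {e}) \ A)) :
    ThmN.RLS M 10 5 := by
  refine rls_five_of_poly_key M 10 hR hfree ?_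
  rw [S2LP.phiK_ten_five]
  exact key_poly_of_two_base _ (by norm_num) 86 (by norm_num) (by norm_num) (by norm_num) _ hn

/-- **The row `p = 11` from `n = 86` on** (`d ≥ 75`). -/
theorem c025_core_five_hyperplane_key_eleven (M : Matroid α) [M.Finite] (hR : M.eRank = ((11 : ℕ) : ℕ∞))
    (hn : 86 ≤ M.E.ncard)
    (hfree : ∀ e ∈ M.E, ∃ A ⊆ M.E \ {e}, e ∉ M.closure A ∧ e ∉ M.closure ((M.E \ {e}) \ A)) :
    ThmN.RLS M 11 5 := by
  refine rls_five_of_poly_key M 11 hR hfree ?_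
  rw [S2LP.phiK_eleven_five]
  exact key_poly_of_two_base _ (by norm_num) 86 (by norm_num) (by norm_num) (by norm_num) _ hn

/-- **The row `p = 12` from `n = 88` on** (`d ≥ 76`). -/
theorem c025_core_five_hyperplane_key_twelve (M : Matroid α) [M.Finite] (hR : M.eRank = ((12 : ℕ) : ℕ∞))
    (hn : 88 ≤ M.E.ncard)
    (hfree : ∀ e ∈ M.E, ∃ A ⊆ M.E \ {e}, e ∉ M.closure A ∧ e ∉ M.closure ((M.E \ {e}) \ A)) :
    ThmN.RLS M 12 5 := by
  refine rls_five_of_poly_key M 12 hR hfree ?_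
  rw [S2LP.phiK_twelve_five]
  exact key_poly_of_two_base _ (by norm_num) 88 (by norm_num) (by norm_num) (by norm_num) _ hn

/-- **The row `p = 13` from `n = 90` on** (`d ≥ 77`). -/
theorem c025_core_five_hyperplane_key_thirteen (M : Matroid α) [M.Finite] (hR : M.eRank = ((13 : ℕ) : ℕ∞))
    (hn : 90 ≤ M.E.ncard)
    (hfree : ∀ e ∈ M.E, ∃ A ⊆ M.E \ {e}, e ∉ M.closure A ∧ e ∉ M.closure ((M.E \ {e}) \ A)) :
    ThmN.RLS M 13 5 := by
  refine rls_five_of_poly_key M 13 hR hfree ?_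
  rw [S2LP.phiK_thirteen_five]
  exact key_poly_of_two_base _ (by norm_num) 90 (by norm_num) (by norm_num) (by norm_num) _ hn

/-- **The row `p = 14` from `n = 92` on** (`d ≥ 78`; `n = 90` holds but `n = 91` does not on the polynomial cap). -/
theorem c025_core_five_hyperplane_key_fourteen (M : Matroid α) [M.Finite] (hR : M.eRank = ((14 : ℕ) : ℕ∞))
    (hn : 92 ≤ M.E.ncard)
    (hfree : ∀ e ∈ M.E, ∃ A ⊆ M.E \ {e}, e ∉ M.closure A ∧ e ∉ M.closure ((M.E \ {e}) \ A)) :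
    ThmN.RLS M 14 5 := by
  refine rls_five_of_poly_key M 14 hR hfree ?_
  rw [S2LP.phiK_fourteen_five]
  exact key_poly_of_two_base _ (by norm_num) 92 (by norm_num) (by norm_num) (by norm_num) _ hn

end HypKey

end PercRepro
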